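import Literature.MathematicalPhysics.QuantumFieldTheory.Balaban1983to89.B9SectCWalkTermsAllNorms
import Literature.MathematicalPhysics.QuantumFieldTheory.Balaban1983to89.DagBinding

/-!
# `Balaban1983to89.B9Carve09Thms310to311Hyp` — [Balaban1985BackgroundPropagators] pp. 415–422 [PDF 27–34] (end of Sect. C,
# Theorems 3.10–3.11, Sect. D up to (3.134)): THE HYPOTHESIS-FORM BUNDLE OF CARVING BLOCK 09, with the one printed clause of the
# block the tree carries only at concrete letters — (3.133) for the literal H of (3.109)–(3.110) — typed over the carriers of `…B9`

statement-level skeleton of published theorems with citation tags; proofs where landed; nothing here is a claim about the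
Yang–Mills mass gap

SOURCE.  T. Bałaban, *Propagators for lattice gauge theories in a background field*, Commun. Math. Phys. **99** (1985) 389–434,
doi:10.1007/bf01240355 [`Balaban1985BackgroundPropagators`] (cell paper "B9"; held `paper:balaban1985-cmp99-background-propagators`,
journal page = PDF page + 388).  Pages 414–423 were read first-hand for this file on the text layer (`lit read … --pages 26-35`) AND
on the page renders `run/shared/lean/pub/pub-balaban/b2b-balaban-ref1/pages/1985-cmp99-background-propagators/…-p027-x4.png` …
`…-p034-x4.png` (the text layer garbles every display).  STATUS of the source: published, refereed.

REVISION v1.1 (doc-only; referee check-4 verdict `carve/CHECK-4.md` § 2026-08-28T06:11:45Z, PASS-WITH-NOTES, 0 MISSTATED): the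
zero-weight notes N-c4-6 (verbatim-quote slips: p. 422 l. 24 reads «include the additional factor (L^{j′}η)⁻¹ in this formula»;
(3.133)'s «‖ζ‖^ξ_β») and N-c4-7 (the (3.85)-smallness field of `B9Thm311Whole.Inputs311` is `small`) applied, and the p. 422
line count aligned with the referee's («ll. 5–9»); NO declaration, statement or proof changed (v1 = p607576, sha16 16a6f982100df190).

WHY THIS FILE (cell `lit-balaban`, P6 CARVING FAN of D-0154 (3b); seat `lit-balaban-carve-09`; block row 09 of
`run/shared/lean/pub/lit-balaban/carve/BLOCKS-01-10.md` = `carve/CARVE-LIST.md` §1 Block 09, rules `carve/CARVE-RULES.md`; KEY item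
`stmt-QuantumFields-20542` (K1⁷ `StabilityBAtRecordR13SepCoPH`, consumer lane N06 [B9]); also-feeds `stmt-QuantumFields-19200`
(G-B9-LETTERS M5.7-est: desk stems `B9Eq3104*`, `B9Thm310CommutatorBound389B`, `B9Thm311PositivityKnitLetter` — CITED here, not
carved into)).  The block is pp. 415–422 = Theorems 3.10, 3.11 and the displays (3.106)–(3.134).  At statement level this stretch is
IN THE TREE (cell SKELETON v3.367: 12 rows — 3 typed-existing, 5 proved-existing, 4 proved; 1 929 in-tree declarations cite a locator
in the range, CARVE-LIST §1) — so, by the fan's rule «IN TREE = CITE, NEVER RESTATE» (CARVE-RULES §2.3), this file (a) RESTATES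
NOTHING: every printed statement of the block that has a declaration is cited BY NAME below (table + census); (b) types the ONE
printed clause of the block the tree has only as a theorem at concrete letters and not in the hypothesis-form currency of `…B9` —
the sentence after (3.133), p. 422: (3.133) *«with an additional factor (Lʲη)⁻¹, or (L^{j′}η)⁻¹»* for the H that solves (3.109)–(3.110)
(`Ineq3133Lit` in the frame of `B9.Ineq3133`, its family form `Stmt3133LitPrinted` in the frame of `B9.Stmt3132Printed`, and the
kernel-checked passage from (3.133) print asserts, `ineq3133Lit_of_ineq3133` ∕ `stmt3133Lit_of_thm312Printed`); (c) conjoins the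
block's printed THEOREM-LEVEL statements, by name, into ONE hypothesis bundle `Hyp` a node prover takes as `(h : Hyp …)` ∕
`(h : HypAt Y termK310)`, with the kernel-checked projections a consumer wants.

## The block's SKELETON rows → the in-tree declarations this file CITES (never restates)

| row | print | in tree (module `…Balaban1983to89.<stem>`) | used here |
|---|---|---|---|
| B9.Thm3.10 | Thm 3.10, (3.107)–(3.108) pp. 415–416 | in tree: `B9.Thm310Printed` (sup entry (3.108), localisation clause, `Converges`); its last clause *«and the corresponding inequalities for norms on the left-hand sides of (3.42)–(3.47). The constant O(1) depends on d and L only»*: `B9SectCWalkTermsAllNorms.Thm310AllNormsPrinted`, `….thm310Printed_of_allNorms`; glued from letters: `B9Thm310Whole.thm310Printed_of_local3107`, `….thm310Printed_of_cor36Printed`; p. 416 *«This implies Theorem 3.3»*: `B9.RWSumsYieldIneqs`, `B9.thm33_of_thm37_310`, `B9Thm310Whole.clause342_of_thm310Printed`, `B9.sectsAC_architecture` | fields `Hyp.t310`, `Hyp.t310all`; `Hyp.t310_of_t310all`, `Hyp.thm33`, `Hyp.atCommonThresholds` |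
| B9.Thm3.11 | Thm 3.11 p. 416 | in tree: `B9.Thm311Printed`; the printed proof: `B9.thm311_core`, `B9Thm311.posDef_of_factor`, `….posDef_of_factor_rowSums` (GAPS G-B9-06), `B9Thm311Whole.Inputs311`, `….posDef_of_factor_small`, `….thm311Printed_of_inputs` (the whole leaf); «obvious for the first three … also for P and R»: `B9Thm311Data.data_g_posDef`, `….data_qggqs_posDef`, `….data_c_posDef`, `B9Thm311Lattice.obvious_311_lattice`, `B9Eq325Proj.R325_symm` ∕ `R325_idem`; «enough to prove a positivity of the operators G_□ … G_□(e^{iηA}) = G_□(1)(I − V(A)G_□(1))⁻¹ … G_□(1) is positive [4]»: `B9Eq387CubeFormCoerciveSmallField.exists_cube_form_coercive_small_field`, `B9Eq387CubeLocalisedProjection.cube_form_ge'`, `B9Thm311SmallFieldCoercivity.exists_coercive_principal_of_small_field`, `B5Eq172FlatCoercivity.exists_coercive_principal_flat₀`; at letters of record: `B9Thm311PureGaugeClassAtLettersR.t311_pureGaugeR_pinned`, `B9Thm311PositivityKnitLetter` (desk stem) | field `Hyp.t311`; `Hyp.posDef_G`, `Hyp.atCommonThresholds` |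
| B9.Eq3.132 | (3.132) p. 422 | in tree: `B9.Ineq3132`, `B9.Stmt3132Printed` (both (QGQ*)⁻¹ and «the same … with G₁»); cores `QGQInverse.inverse_decay`, `B9Eq3132Whole.CTInputs`, `B9Eq3132SectDLetters.*` | field `Hyp.s3132`; `Hyp.ineq3132` |
| B9.Eq3.109 | (3.109)–(3.112) p. 417 | in tree, PROVED (finite-dimensional model): `B9Eq3112.hOp`, `dcon`, `slice`, `eq_3109_min`, `eq_3109_split`, `eq_3111`, `eq_3112`, `Z_pos`, `eq_3112_normalised`, `min_3109_value`, `H_eq_3126`, `kernelForm_posDef` | cited (a theorem is not a hypothesis) |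
| B9.Eq3.113 | (3.113)–(3.115) p. 418 | in tree, PROVED: `B9Eq3113Proof.tHol_pureGauge`, `tild_pureGauge`, `dbavgCov_pureGauge`, `hasDerivAt_mlog_dbavgCov_uexp` ((3.113) and the two pure-gauge displays after it), `B9Eq3114Proof.wframe_pureGauge_R0avg`, `dbavgCov_pureGauge_R0avg`, `eq3114`, `eq3114_zd`, `eq3115`, `linCovIter_covU`; «the average QA are invariant with respect to gauge transformations λ … λ ∈ N(Q′)»: `B9Eq3114Proof.linQcov_covU_eq_zero_of_Qp`, `linCovIter_gauge_of_null`, `B9Eq3183.avg_gauge`; D̄ʲ: `B9Eq3169Mu.cod`, `hol` | cited |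
| B9.Eq3.116 | (3.116)–(3.117) pp. 418–419 | in tree, PROVED: `B9Eq3117Current.bch2`, `gaugeFl_fluct`, `sum_letters3`, `divB_J_eq_zero` (D*J = 0), `bondPair_covDη_J` (⟨Dλ, J⟩ = 0), `Eq3117QuadShift_holds` ((3.117)₂), `B9Eq3117Polarized`; «J … is small, if U satisfies the condition (3.36)»: `B9Eq336CurrentBound.norm_J_le_local` | cited |
| B9.Eq3.118 | (3.118)–(3.120) p. 419 | in tree, PROVED: `B9SectDFP.piOp`, `tOp`, `eq_3118`, `eq_3118_identity`, `eq_3119`, `piOp_gauge`, `piOp_mul_gauge`, `tOp_mul_gauge`, `R_mul_Dt_mul_tOp` («obtained by gauge transforming … to the subspace {A : RD*A = 0}»), `B9Eq3117Current.eq3120`, `deltaPiPrime`; natively `B9Eq3119DeltaPiCarrier.piOfU`, `deltaPiOfU`, `B9Eq3119InvariantExtension`, `B9Eq3119DeltaPiTower*` | cited |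
| B9.Eq3.121 | (3.121)–(3.126) pp. 419–420 | in tree, PROVED: `B9SectDFP.eq_3121_Q`, `eq_3121_R`, `eq_3121_exponent`, `eq_3121_lambda`, `eq_3121_field`, `Ginv`, `eq_3122`, `Ginv_posDef_of_Δa`, `lagrange_3123` (the Lagrange display), `eq_3123`, `eq_3124`, `eq_3125_lambda`, `eq_3126`; `B9Eq3121Measure.eq_3121`, `eq_3121_3123`, `eq_3125`; `B9Eq3125Moment`; `B9Eq3124GaugeModes.h124_RLatticeK`, `h124'_RLatticeK`; H at the torus letters `B9Eq315QTorusOnto.H1ofBackground`, `B9Eq326OperatorAssembly.H1ofU` | cited |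
| B9.Eq3.127 | (3.127)–(3.129) p. 421 | in tree, PROVED ∕ BODIED: `B9Eq3152.G1inv`, `G1inv_eq`, `eq_3128`, `eq_3129`, `G1inv_posDef_of_Δa`, `eq_3124_G1`, `sectD_hypotheses_G1`; the second-order term C⁽²⁾: `B7Eq136SecondOrder`, `B9Eq3134MatrixConcrete.calC` | cited |
| B9.Eq3.130 | (3.130)–(3.131) pp. 421–422 | in tree, PROVED: `B9Eq386Neumann.eq386_inverse_form`, `B9SectDL2Decay.resolvent_fix`, `B9SectDWeightedNeumann.neumann_majorant_wrow`, `B9SectDSup.global_bound`, `B9Eq3130NeumannLetter.letter_bootstrap_pair`; (3.131): `B9Ineq3131Letters.ineq3131_letters`, `B9Ineq3131Assembly.ineq3131_assembled`, `B9Eq3131Pointwise` | cited |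
| B9.Eq3.133 | (3.133) p. 422 | in tree: `B9.HKernel`, `B9.Ineq3133`, `B9.ineq3133_restrict` (the H of (3.126)); the family statement is a clause of `B9.Thm312Printed` (Thm 3.12, block 10); PROVED as print derives it: `B9Ineq3133Assembly.ineq3133_printed`, `B9Ineq3133KernelConcrete.ineq3133_sup_printed`; the literal-H sentence, sup members at concrete letters: `….ineq3133_sup_literal` | `ineq3133_H_of_thm312Printed`; NEW hypothesis-form `Ineq3133Lit`, `Stmt3133LitPrinted` (+ `ineq3133Lit_of_ineq3133`, `stmt3133Lit_of_thm312Printed`) |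
| B9.Eq3.134 | (3.134) p. 422 | in tree, BODIED ∕ PROVED: `B9Delta2Def134.delta2`, `eq_3134`, `delta2_unique`; `B9Eq336CurrentBound.*` ((3.135)–(3.137) = block 10) | cited |

## Census of the REMAINING printed statements of pp. 415–422 (displays without a row of their own + every sentence that asserts something)

* (3.106) p. 414 (first display of the block's range; page = block 08): PROVED `B9Eq3105Sum.eq3106_series_eq`, `eq3106_twoSided`: cited.
* p. 415 l. 1–25 (construction of the partitions 𝒟′, 𝒟″ for the expansion of P in (3.105); *«□̃₀² = □̃⁴, or □̃₀² = □̃₁⁴, and the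
  boundary conditions are outside □̃⁸, or □̃₁⁸»*): `B9SectCCubes.p415_tilde0_two`, `p415_tilde0_five`, `B9SectCRefine.p415_hsecond_eq_one`: cited.
  *«The term in the second sum gives rise to small terms … localizations introduced by 1 − ζ_□̃ and h_□ are separated by a distance ≧ M»* —
  proof narration by reference to the analysis of (3.96)–(3.98) (block 08; `B9Thm39Sum`, `B9Eq395Small.term397_majorant`): no statement of its own.
* p. 415, the three unnumbered displays («ζ_□̃Dh′_{□₀}G′_{□₀}h′_{□₀}Q′*…», «ζ_□̃DG′_□ζ_□̃Q′*ζ_□̃C_□ζ_□̃Q′ζ_□̃G′_□D*h_□G_□h_□», «… = ζ_□̃DP_□D*h_□G_□h_□»)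
  and *«This expression cancels the second term in the third sum»*: PROVED `B9Eq3105Sum.zsweep_mul_eq`, `zsweep_415`, `cancel_415`: cited.
* p. 415 *«Thus we have decomposed R and G into convergent expansions, the terms in the expansion of R being small»* — the content of
  Theorem 3.10 and of p. 414's «R satisfies the bound (3.85) with O(M⁻¹)» (block 08; `B9Thm311Whole.Inputs311.small` reads it, in the displayed L² form): no new statement.
* p. 416 l. 9–12 (after (3.108)) — see row B9.Thm3.10 («This implies Theorem 3.3»): cited; kernel-checked here as `Hyp.thm33`.
* p. 416, Theorem 3.11's parenthesis *«(i.e. for M sufficiently large and α₀ sufficiently small)»* — ENCODED by the quantifier template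
  of `B9.Thm311Printed` (M₃, a₀ BEFORE the member i); kernel-checked across the block as `Hyp.atCommonThresholds`.
* p. 416, proof of Theorem 3.11 (every sentence) — see row B9.Thm3.11: cited.
* p. 417 l. 1–3 *«generalizations of the operators H and P constructed in [3] by the formulas (1.103) and (1.107)»* — the ONE «residual
  candidate» of CARVE-LIST §1 Block 09 («(1.107) p.417:L3») is this cross-reference to [3] = [Balaban1984PropagatorsI] (1.103), (1.107),
  in tree as `B5Hk103Minimizer.HB`, `B5Identities197.proj107`, `B5Proj107L2Zd.PZd`: not a [B9] display, nothing to type.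
* p. 417 *«The variational problem (3.109), (3.110) has a unique solution … follows from positive definiteness of the operator Δ_a»*,
  *«This formula can be proved easily by making the translation A = A′ + HB»*, *«The integrals in (3.112) are convergent»* — PROVED
  `B9Eq3112.eq_3109_min`, `kernelForm_posDef`, `eq_3112`, `Z_pos`: cited.  *«the factor Lʲη is unessential … we will write the first
  condition in (3.110) as Q(U)A = B»*, *«all operators are defined on Ω₀ also, with Dirichlet boundary conditions on Ω₀ᶜ»* — conventions.
* p. 418 *«Q_j(A − Dλ) = Q_jA − Q_jDλ»* — linearity, `B7Prop3GeneralTild.linQcov_add`: cited.  (3.113)–(3.116) and prose: row B9.Eq3.113 ∕ 3.116.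
* p. 419 *«From now on we assume that U satisfies the regularity conditions (3.35), (3.36)»* — ENCODED: `Reg335 ∧ Reg336` in
  `B9.Stmt3132Printed`, `B9.Thm312Printed`, `Stmt3133LitPrinted` below.  *«The quadratic form is invariant with respect to gauge
  transformations determined by λ ∈ N(Q′)»*, *«A − DG′RD*A has this invariance property»* — `B9SectDFP.piOp_gauge`, `tOp_mul_gauge`: cited.
  *«The quadratic form Δ′_π is a small perturbation of Δ»* — = (3.131): cited.
* p. 420 *«QA is gauge invariant with respect to gauge transformations satisfying this condition»*, the Lagrange display, *«We will
  prove that the second term in the last line vanishes»* — `B9SectDFP.eq_3121_Q`, `lagrange_3123`, `eq_3124`: cited.  p. 420 last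
  paragraph – p. 421 l. 2 (*«G … has all the properties formulated in Theorems 3.3, 3.10, 3.11 … (QGQ*)⁻¹ … analysis is very similar»*)
  = Theorem 3.12 (block 10, `B9.Thm312Printed`) and (3.132) (`B9.Stmt3132Printed`): cited.
* p. 421 *«The function C⁽²⁾(A) is defined at bonds of 𝔅, and on Λ_j it coincides with C_j⁽²⁾(LʲηA)»*, *«we take H given by (3.126), and
  C⁽²⁾(A) equals to LʲηC_j⁽²⁾(A) on Λ_j»* — the object: `B7Eq136SecondOrder`, `B9Eq3134MatrixConcrete.calC` (with the level factors): cited.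
  *«G₀ = (Δ + DRD* + Q*aQ)⁻¹»*, *«It is easy to find estimates for the operator Δ′_π …»* + the example term — row B9.Eq3.130: cited.
* p. 422 ll. 5–9 (after (3.131)) *«… a convergence of the series (3.130), for α₀ sufficiently small, in all norms … except the
  inequality involving the Laplace operator in (3.42). Thus we have Theorem 3.3 for G, with this exception. Of course Theorem 3.10 holds
  also … each operator Δ′_π provides the small factor α₀»* — the G-clauses of Theorem 3.12 (`B9.Thm312Printed`, block 10; glued
  `B9Thm312Whole*`, `B9Thm312WholeLeaf`): cited, and projected here (`thm33noLap_G_of_thm312Printed`).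
* p. 422 *«The operators (QGQ*)⁻¹, or (QG₁Q*)⁻¹, can be analyzed in the same way as the operator (Q′G′²Q′*)⁻¹. We will not repeat
  these considerations here, let us write only bounds»* — by-analogy claim GAPS G-B9-15, carried by `B9.Stmt3132Printed`'s docstring: cited.
* p. 422, the sentence after (3.133) — the literal H: sup members PROVED at concrete letters (`ineq3133_sup_literal`); hypothesis-form
  over `…B9`'s carriers NOT in tree ⇒ TYPED BELOW (`Ineq3133Lit`, `Stmt3133LitPrinted`).
* p. 422 after (3.134) (*«A meaning of Δ_π⁽²⁾ is obvious»*, (3.135), (3.136), *«|(H*J)(b)| ≦ O(1)Mα₀(Lʲη)⁻³»*) — displays (3.135) ff. =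
  block 10 (`B9Delta2Def134.delta2pi`, `eq_3135`, `eq_3136`, `B9Ineq3137Regular.ineq3137a_of_3133_regular`): boundary, not this block.

RESULT OF THE CENSUS: one printed clause of the block without a hypothesis-form declaration — (3.133) for the literal H of
(3.109)–(3.110) — typed below (§3); everything else is cited.

## What is here
* §1 `Hyp` — ONE `Prop`-valued structure conjoining BY NAME `B9.Thm310Printed`, `B9SectCWalkTermsAllNorms.Thm310AllNormsPrinted`,
  `B9.Thm311Printed`, `B9.Stmt3132Printed` (explicit carriers: family index `I`, `d`, `c35`, `geo`, `bg`, the expansion carrier `E310`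
  of (3.107) with its walk-indexed kernel family `termK310`, the positivity reading `PosDef`, the site kernels `QGQinv`, `QG1Qinv`);
  `HypAt` — the same keyed to the consumer's carrier record `DagBinding.PrintedCarriers9X` (N06's leaf vocabulary).
* §2 kernel-checked bookkeeping out of `Hyp` (no statement asserted): `hypAt_iff`, `hypAt_of_b9LeafX` (the extended leaf
  `DagBinding.B9LeafX` + the all-norms clause give the bundle), `HypAt.leafFields`, `Hyp.t310_of_t310all`, `Hyp.thm33` (p. 416),
  ★ `Hyp.atCommonThresholds` (p. 416's parenthesis: ONE pair of thresholds serving Thm 3.10's convergence, localisation and (3.108),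
  Thm 3.11's five positivities, and (3.132), at once), `Hyp.posDef_G`, `Hyp.ineq3132`; and p. 422's sentences located as projections of
  block 10's `B9.Thm312Printed`: `thm33noLap_G_of_thm312Printed`, `ineq3133_H_of_thm312Printed`.
* §3 `Ineq3133Lit`, `Stmt3133LitPrinted` (hypothesis-form, the block's residual clause), `ineq3133Lit_of_ineq3133`,
  `stmt3133Lit_of_thm312Printed` (print's «we get», kernel-checked modulo the column dictionary `H_lit(·, y′) = H(·, y′)(L^{j′}η)⁻¹`).

## HONEST SCOPE — what is NOT claimed
Nothing of [B9] is proved here and no `…Printed` statement is asserted: `Hyp` is a HYPOTHESIS bundle, `Ineq3133Lit` ∕ `Stmt3133LitPrinted`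
are hypothesis-form statements; the theorems are bookkeeping between typed shapes.  The cell's GAPS rows travel with the cited names
(G-B9-04 the «(3.95)» slip of Thm 3.10, G-B9-06 Thm 3.11's L²-smallness of R, G-B9-07 Sect. C proofs by reference, G-B9-15 (3.132) by
analogy, G-B9-16 the perturbation series behind Thm 3.12).  No summit statement is proved by this seat; N06 is NOT discharged; the file
moves no node count; one finite lattice paper — nothing continuum ∕ ℝ⁴ ∕ OS ∕ mass-gap ∕ Clay.  No `sorry`, no `instance`, no `notation`,
no attribute manipulation; imports `…B9SectCWalkTermsAllNorms` (hence `…B9`) and `…DagBinding` only.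
-/

namespace Literature.MathematicalPhysics.QuantumFieldTheory.Balaban1983to89.B9Carve09Thms310to311Hyp

open B9 B9SectCWalkTermsAllNorms DagBinding

/-! ## §1 The block-09 hypothesis bundle -/

/-- **BLOCK 09 OF [B9] AS ONE HYPOTHESIS BUNDLE** (pp. 415–422 [PDF 27–34]): the printed theorem-level statements of the block that
the tree carries in hypothesis form over the carriers of `…B9`, conjoined BY NAME —
`t310` = **Theorem 3.10** (pp. 415–416, verbatim in `B9.Thm310Printed`: *«For M sufficiently large, and a configuration U satisfying
(3.95) [sic, (3.35) — GAPS G-B9-04], the operator G has the expansion G = Σ_ω R₀(X₀)R_{α₁}(X₁)·⋯·R_{αₙ}(Xₙ), (3.107) the sum is over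
walks ω = ((0, X₀), (α₁, X₁), …, (αₙ, Xₙ)) satisfying X_{i−1} ∩ X_i ≠ ∅, i = 1, …, n. A term in this expansion, corresponding to a walk
ω, depends on configuration U restricted to X̃⁵₀ ∪ X̃⁵₁ ∪ … ∪ X̃⁵ₙ, satisfies the inequality |(R₀(X₀)R_{α₁}(X₁)·⋯·R_{αₙ}(Xₙ)J)(x)| ≦
O(1)(Lʲη)²O(M^{−1/2})^{|ω|}M^{−1/2|ω|}e^{−(1/2)δ₀d(ω,y,y′)}|J|, x ∈ Δ(y), y ∈ Λ_j, supp J ⊂ Δ(y′), (3.108)»*); `t310all` = its clause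
*«and the corresponding inequalities for norms on the left-hand sides of (3.42)–(3.47). The constant O(1) depends on d and L only»*
(`B9SectCWalkTermsAllNorms.Thm310AllNormsPrinted`, the ω-terms seen through the walk-indexed kernel family `termK310`); `t311` =
**Theorem 3.11** (p. 416, `B9.Thm311Printed`: *«Under the assumptions of the Theorems 3.1–3.10 (i.e. for M sufficiently large and α₀
sufficiently small) the operators Δ′_a, G′, (Q′G′²Q′*)⁻¹, Δ_a, G are positive definite»*); `s3132` = **(3.132)** (p. 422,
`B9.Stmt3132Printed`: *«|(QGQ*)⁻¹(y, y′)| ≦ O(1)(Lʲη)⁻²(L^{j′}η)^{−d}e^{−δ₁d(y,y′)} for y ∈ Λ_j, y′ ∈ Λ_{j′}, (3.132) and the same for the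
operator with G₁ instead of G»*).  The other displays of the block ((3.109)–(3.131), (3.134)) are PROVED ∕ BODIED in the sibling
modules of the module docstring's table and take no slot; (3.133) is a clause of Theorem 3.12 (block 10).  Hypothesis slot only;
nothing asserted. [cite: Balaban1985BackgroundPropagators, Thm 3.10 (3.107)–(3.108) pp.415–416, Thm 3.11 p.416, (3.132) p.422] -/
structure Hyp {I : Type} (d : ℕ) (c35 : ℝ) (geo : I → Geometry) (bg : I → Backgrounds)
    (E310 : ∀ i, RWExpansion (geo i) (bg i)) (termK310 : ∀ i, (E310 i).Walk → KernelFamily (geo i) (bg i))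
    (PosDef : ∀ i, Fin 5 → (bg i).Cfg → Prop) (QGQinv QG1Qinv : ∀ i, SiteKernel (geo i) (bg i)) : Prop where
  /-- Theorem 3.10 (3.107)–(3.108), pp. 415–416 — in tree: `B9.Thm310Printed`. -/
  t310 : Thm310Printed c35 geo bg E310
  /-- Theorem 3.10, the all-norms clause p. 416 — in tree: `B9SectCWalkTermsAllNorms.Thm310AllNormsPrinted`. -/
  t310all : Thm310AllNormsPrinted c35 geo bg E310 termK310
  /-- Theorem 3.11, p. 416 — in tree: `B9.Thm311Printed`. -/
  t311 : Thm311Printed c35 geo bg PosDef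
  /-- (3.132), p. 422, for (QGQ*)⁻¹ and (QG₁Q*)⁻¹ — in tree: `B9.Stmt3132Printed`. -/
  s3132 : Stmt3132Printed d c35 geo bg QGQinv QG1Qinv

/-- **The bundle keyed to the consumer's carriers** `DagBinding.PrintedCarriers9X` (the record over which N06's extended leaf
`DagBinding.B9LeafX` is stated): `Hyp` at `Y.d9, Y.c35, Y.geo9, Y.bg9, Y.E310, Y.PosDef, Y.QGQinv, Y.QG1Qinv`, the walk-indexed
kernel family of the all-norms clause being the one extra carrier.
[cite: Balaban1985BackgroundPropagators, Thm 3.10 (3.107)–(3.108) pp.415–416, Thm 3.11 p.416, (3.132) p.422] -/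
def HypAt (Y : PrintedCarriers9X) (termK310 : ∀ i, (Y.E310 i).Walk → KernelFamily (Y.geo9 i) (Y.bg9 i)) : Prop :=
  Hyp Y.d9 Y.c35 Y.geo9 Y.bg9 Y.E310 termK310 Y.PosDef Y.QGQinv Y.QG1Qinv

/-! ## §2 Bookkeeping (kernel-checked uses of the cited declarations) -/

section Leaf

variable (Y : PrintedCarriers9X) (termK310 : ∀ i, (Y.E310 i).Walk → KernelFamily (Y.geo9 i) (Y.bg9 i))

/-- `HypAt` unfolds to `Hyp` at the record's carriers. [cite: Balaban1985BackgroundPropagators, Thm 3.10 pp.415–416 (bookkeeping)] -/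
theorem hypAt_iff : HypAt Y termK310 ↔ Hyp Y.d9 Y.c35 Y.geo9 Y.bg9 Y.E310 termK310 Y.PosDef Y.QGQinv Y.QG1Qinv := Iff.rfl

/-- **The extended B9 leaf contains the block**: `DagBinding.B9LeafX Y` (its fields `numbered.t310`, `numbered.t311`, `s3132`)
together with Theorem 3.10's all-norms clause gives `HypAt Y`. [cite: Balaban1985BackgroundPropagators, Thm 3.10 p.416, Thm 3.11 p.416, (3.132) p.422 (bookkeeping)] -/
theorem hypAt_of_b9LeafX (hX : B9LeafX Y) (hall : Thm310AllNormsPrinted Y.c35 Y.geo9 Y.bg9 Y.E310 termK310) :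
    HypAt Y termK310 :=
  ⟨hX.numbered.t310, hall, hX.numbered.t311, hX.s3132⟩

/-- Conversely the block bundle returns the three leaf fields it is responsible for (`B9Leaf.t310`, `B9Leaf.t311`,
`B9LeafX.s3132`), in the leaf's own types. [cite: Balaban1985BackgroundPropagators, Thm 3.10 p.416, Thm 3.11 p.416, (3.132) p.422 (bookkeeping)] -/
theorem HypAt.leafFields (h : HypAt Y termK310) :
    Thm310Printed Y.c35 Y.geo9 Y.bg9 Y.E310 ∧ Thm311Printed Y.c35 Y.geo9 Y.bg9 Y.PosDef ∧
      Stmt3132Printed Y.d9 Y.c35 Y.geo9 Y.bg9 Y.QGQinv Y.QG1Qinv :=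
  ⟨h.t310, h.t311, h.s3132⟩

end Leaf

section Explicit

variable {I : Type} {d : ℕ} {c35 : ℝ} {geo : I → Geometry} {bg : I → Backgrounds}
  {E310 : ∀ i, RWExpansion (geo i) (bg i)} {termK310 : ∀ i, (E310 i).Walk → KernelFamily (geo i) (bg i)}
  {PosDef : ∀ i, Fin 5 → (bg i).Cfg → Prop} {QGQinv QG1Qinv : ∀ i, SiteKernel (geo i) (bg i)}

/-- **The two Theorem-3.10 fields cohere**: under the reading that the expansion carrier's `term` IS the sup entry n = 0 of the
walk-indexed family (`hterm`, the reading `…B9` gives `RWExpansion.term`), the all-norms field alone yields the sup-only field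
(`B9SectCWalkTermsAllNorms.thm310Printed_of_allNorms`). [cite: Balaban1985BackgroundPropagators, Thm 3.10 (3.108) p.416 (bookkeeping)] -/
theorem Hyp.t310_of_t310all (h : Hyp d c35 geo bg E310 termK310 PosDef QGQinv QG1Qinv)
    (hterm : ∀ (i : I) (U : (bg i).Cfg) (ω : (E310 i).Walk) (lam : (geo i).Loc) (y : (geo i).Site),
      (E310 i).term U ω lam y = (termK310 i ω).e 0 U lam y) :
    Thm310Printed c35 geo bg E310 :=
  B9SectCWalkTermsAllNorms.thm310Printed_of_allNorms hterm h.t310all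

/-- **p. 416: «From (3.108) it follows that the expansion (3.107) is convergent in all norms in the inequalities (3.42)–(3.47).
This implies Theorem 3.3.»** — with Theorem 3.7 (`B9.Thm37Printed`, the expansion (3.90) of G′) and the by-reference summation
leaf `B9.RWSumsYieldIneqs` (p. 409 ∕ p. 416), the block's `t310` gives Theorem 3.3 as typed (`B9.thm33_of_thm37_310`).
[cite: Balaban1985BackgroundPropagators, Thm 3.10 ⇒ Thm 3.3 p.416] -/
theorem Hyp.thm33 (h : Hyp d c35 geo bg E310 termK310 PosDef QGQinv QG1Qinv)
    (E37 : ∀ i, RWExpansion (geo i) (bg i)) (Gp GA : ∀ i, KernelFamily (geo i) (bg i))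
    (t37 : Thm37Printed c35 geo bg E37) (hsum : RWSumsYieldIneqs geo bg E37 E310 Gp GA) :
    Thm33Printed c35 geo bg Gp GA :=
  thm33_of_thm37_310 c35 geo bg E37 E310 Gp GA t37 h.t310 hsum

/-- **p. 416: «Under the assumptions of the Theorems 3.1–3.10 (i.e. for M sufficiently large and α₀ sufficiently small)»** —
ONE pair of thresholds (M⋆, a⋆) and one set of constants serving the whole block at once: for every member with M ≧ M⋆, every
0 < α₀ with Mα₀ ≦ a⋆ and every U in the class (3.35), the expansion (3.107) converges, every ω-term is U-localised and obeys
(3.108), the five operators of Theorem 3.11 are positive definite, and — if U is also in the class (3.36) (p. 419 *«From now on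
we assume that U satisfies the regularity conditions (3.35), (3.36)»*) — (3.132) holds for (QGQ*)⁻¹ and (QG₁Q*)⁻¹ (kernel-checked
max ∕ min bookkeeping over the three cited statements). [cite: Balaban1985BackgroundPropagators, Thm 3.11 p.416, Thm 3.10 (3.108) p.416, (3.132) p.422 (bookkeeping)] -/
theorem Hyp.atCommonThresholds (h : Hyp d c35 geo bg E310 termK310 PosDef QGQinv QG1Qinv) :
    ∃ Mstar astar δ₀ C c δ₁ C' : ℝ, 0 < Mstar ∧ 0 < astar ∧ 0 < δ₀ ∧ 0 < C ∧ 0 < c ∧ 0 < δ₁ ∧ 0 < C' ∧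
      ∀ i : I, Mstar ≤ (geo i).M → ∀ α₀ : ℝ, 0 < α₀ → (geo i).M * α₀ ≤ astar →
        ∀ U : (bg i).Cfg, (bg i).Reg335 c35 α₀ U →
          (E310 i).Converges U ∧
          (∀ (ω : (E310 i).Walk) (J : (geo i).Loc) (y y' : (geo i).Site),
            (E310 i).first ω y → (E310 i).last ω y' → (geo i).suppIn J y' →
              (E310 i).LocDep U ω ∧
              (E310 i).term U ω J y ≤ ((geo i).len y) ^ 2 *
                walkFactor C c (geo i).M δ₀ ((E310 i).wlen ω) ((E310 i).wdist ω y y') * (geo i).supNorm J) ∧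
          (∀ n : Fin 5, PosDef i n U) ∧
          ((bg i).Reg336 c35 α₀ U → Ineq3132 d (QGQinv i) C' δ₁ U ∧ Ineq3132 d (QG1Qinv i) C' δ₁ U) := by
  obtain ⟨M₂, a₂, δ₀, C, c, hM₂, ha₂, hδ₀, hC, hc, H10⟩ := h.t310
  obtain ⟨M₃, a₃, hM₃, ha₃, H11⟩ := h.t311
  obtain ⟨M₄, δ₁, a₄, C', hM₄, hδ₁, ha₄, hC', H32⟩ := h.s3132
  refine ⟨max (max M₂ M₃) M₄, min (min a₂ a₃) a₄, δ₀, C, c, δ₁, C',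
    lt_max_of_lt_right hM₄, lt_min (lt_min ha₂ ha₃) ha₄, hδ₀, hC, hc, hδ₁, hC', ?_⟩
  intro i hMi α₀ hα hMa U hU
  have hM₂i : M₂ ≤ (geo i).M := le_trans (le_trans (le_max_left _ _) (le_max_left _ _)) hMi
  have hM₃i : M₃ ≤ (geo i).M := le_trans (le_trans (le_max_right _ _) (le_max_left _ _)) hMi
  have hM₄i : M₄ ≤ (geo i).M := le_trans (le_max_right _ _) hMi
  have ha₂i : (geo i).M * α₀ ≤ a₂ := le_trans hMa (le_trans (min_le_left _ _) (min_le_left _ _))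
  have ha₃i : (geo i).M * α₀ ≤ a₃ := le_trans hMa (le_trans (min_le_left _ _) (min_le_right _ _))
  have ha₄i : (geo i).M * α₀ ≤ a₄ := le_trans hMa (min_le_right _ _)
  obtain ⟨hconv, hterm⟩ := H10 i hM₂i α₀ hα ha₂i U hU
  exact ⟨hconv, hterm, H11 i hM₃i α₀ hα ha₃i U hU, fun h36 => H32 i hM₄i α₀ hα ha₄i U hU h36⟩

/-- **p. 416: «hence it is enough to prove it for G»** — the n = 4 clause of Theorem 3.11 (G = (Δ_a)⁻¹ positive definite) at
the theorem's own thresholds, projected from `t311`. [cite: Balaban1985BackgroundPropagators, Thm 3.11 p.416 (bookkeeping)] -/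
theorem Hyp.posDef_G (h : Hyp d c35 geo bg E310 termK310 PosDef QGQinv QG1Qinv) :
    ∃ M₃ a₀ : ℝ, 0 < M₃ ∧ 0 < a₀ ∧ ∀ i : I, M₃ ≤ (geo i).M → ∀ α₀ : ℝ, 0 < α₀ → (geo i).M * α₀ ≤ a₀ →
      ∀ U : (bg i).Cfg, (bg i).Reg335 c35 α₀ U → PosDef i 4 U := by
  obtain ⟨M₃, a₀, hM, ha, H⟩ := h.t311
  exact ⟨M₃, a₀, hM, ha, fun i hMi α₀ hα hMa U hU => H i hMi α₀ hα hMa U hU 4⟩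

/-- **(3.132) at one member and one configuration**, both kernels, projected from `s3132`.
[cite: Balaban1985BackgroundPropagators, (3.132) p.422 (bookkeeping)] -/
theorem Hyp.ineq3132 (h : Hyp d c35 geo bg E310 termK310 PosDef QGQinv QG1Qinv) :
    ∃ M₄ δ₁ a₀ C : ℝ, 0 < M₄ ∧ 0 < δ₁ ∧ 0 < a₀ ∧ 0 < C ∧
      ∀ i : I, M₄ ≤ (geo i).M → ∀ α₀ : ℝ, 0 < α₀ → (geo i).M * α₀ ≤ a₀ →
        ∀ U : (bg i).Cfg, (bg i).Reg335 c35 α₀ U → (bg i).Reg336 c35 α₀ U →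
          ∀ y y' : (geo i).Site,
            |(QGQinv i).ker U y y'| ≤ C * ((geo i).len y) ^ (-(2 : ℝ)) * ((geo i).len y') ^ (-(d : ℝ)) *
                Real.exp (-(δ₁ * (geo i).dist y y')) ∧
            |(QG1Qinv i).ker U y y'| ≤ C * ((geo i).len y) ^ (-(2 : ℝ)) * ((geo i).len y') ^ (-(d : ℝ)) *
                Real.exp (-(δ₁ * (geo i).dist y y')) := by
  obtain ⟨M₄, δ₁, a₀, C, hM, hδ, ha, hC, H⟩ := h.s3132
  refine ⟨M₄, δ₁, a₀, C, hM, hδ, ha, hC, fun i hMi α₀ hα hMa U hU h36 y y' => ?_⟩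
  obtain ⟨h1, h2⟩ := H i hMi α₀ hα hMa U hU h36
  exact ⟨h1 y y', h2 y y'⟩

end Explicit

/-! ### p. 422's running-text sentences, located as projections of Theorem 3.12 (`B9.Thm312Printed`, block 10) -/

section FromThm312

variable {I : Type} {d : ℕ} {c35 : ℝ} {geo : I → Geometry} {bg : I → Backgrounds}
  {GD G₁ : ∀ i, KernelFamily (geo i) (bg i)} {H H₁ : ∀ i, HKernel (geo i) (bg i)}
  {HasRWExp : ∀ i, KernelFamily (geo i) (bg i) → (bg i).Cfg → ℝ → Prop}
  {HasRWExpH : ∀ i, HKernel (geo i) (bg i) → (bg i).Cfg → ℝ → Prop}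
  {PosDefK : ∀ i, KernelFamily (geo i) (bg i) → (bg i).Cfg → Prop}

/-- **p. 422 [PDF 34] ll. 5–9: «This inequality and Theorem 3.3 for G₀ imply a convergence of the series (3.130), for α₀
sufficiently small, in all norms appearing on the left-hand sides of the inequalities (3.42)–(3.47), except the inequality
involving the Laplace operator in (3.42). Thus we have Theorem 3.3 for G, with this exception. Of course Theorem 3.10 holds also
because we replace each operator in (3.130) by its random walk expansion.»** — the tree types this conclusion as the G-clauses of
Theorem 3.12 (`B9.Thm312Printed`, p. 423); here they are projected for the Sect. D propagator G = (Δ_π + DRD* + Q*aQ)⁻¹ alone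
(`B9.Ineq342_346_347_noLap`, the Hölder entries `B9.Ineq343_345`, the expansion clause `HasRWExp`).
[cite: Balaban1985BackgroundPropagators, p.422 (after (3.131)), Thm 3.12 p.423 (bookkeeping)] -/
theorem thm33noLap_G_of_thm312Printed (h : Thm312Printed d c35 geo bg GD G₁ H H₁ HasRWExp HasRWExpH PosDefK) :
    ∃ M₄ δ₀ a₀ B₀ : ℝ, ∃ Bβ Bε : ℝ → ℝ, ∃ Bεβ : ℝ → ℝ → ℝ, 0 < M₄ ∧ 0 < δ₀ ∧ 0 < a₀ ∧ 0 < B₀ ∧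
      ∀ i : I, M₄ ≤ (geo i).M → ∀ α₀ : ℝ, 0 < α₀ → (geo i).M * α₀ ≤ a₀ →
        ∀ U : (bg i).Cfg, (bg i).Reg335 c35 α₀ U → (bg i).Reg336 c35 α₀ U →
          Ineq342_346_347_noLap (GD i) B₀ δ₀ U ∧ Ineq343_345 (GD i) Bβ Bε Bεβ δ₀ U ∧ HasRWExp i (GD i) U δ₀ := by
  obtain ⟨M₄, δ₀, a₀, B₀, Bβ, Bε, Bεβ, hM, hδ, ha, hB, HH⟩ := h
  refine ⟨M₄, δ₀, a₀, B₀, Bβ, Bε, Bεβ, hM, hδ, ha, hB, fun i hMi α₀ hα hMa U hU h36 => ?_⟩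
  obtain ⟨hK, -⟩ := HH i hMi α₀ hα hMa U hU h36
  obtain ⟨h1, h2, h3, -⟩ := hK (GD i) (by simp)
  exact ⟨h1, h2, h3⟩

/-- **p. 422 [PDF 34], (3.133) for the operator H = GQ*(QGQ*)⁻¹ of (3.126): «The above inequality together with Theorem 3.3 for
G … give |H_{μν}(x, y′)|, |∇H_{μν}(x, y′)|, ‖ζ∇H(·, y′)‖_β ≦ O(1)[1, (Lʲη)⁻¹, (‖ζ‖^ξ_β + |ζ|)(Lʲη)^{−1−β}](L^{j′}η)^{−d}e^{−(1/2)δ₁d(y,y′)},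
… (3.133)»** — the family statement is a clause of Theorem 3.12 (`B9.Thm312Printed`: *«the inequality (3.133) … hold[s] for the
operators H, H₁»*); projected here for H alone, in the one-configuration predicate `B9.Ineq3133` (its proof from (3.132) and
Theorem 3.3 for G, as print says, is `B9Ineq3133Assembly.ineq3133_printed`).
[cite: Balaban1985BackgroundPropagators, (3.133) p.422, Thm 3.12 p.423 (bookkeeping)] -/
theorem ineq3133_H_of_thm312Printed (h : Thm312Printed d c35 geo bg GD G₁ H H₁ HasRWExp HasRWExpH PosDefK) :
    ∃ M₄ δ₀ a₀ B₀ : ℝ, ∃ Bβ : ℝ → ℝ, 0 < M₄ ∧ 0 < δ₀ ∧ 0 < a₀ ∧ 0 < B₀ ∧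
      ∀ i : I, M₄ ≤ (geo i).M → ∀ α₀ : ℝ, 0 < α₀ → (geo i).M * α₀ ≤ a₀ →
        ∀ U : (bg i).Cfg, (bg i).Reg335 c35 α₀ U → (bg i).Reg336 c35 α₀ U →
          Ineq3133 d (H i) B₀ Bβ δ₀ U ∧ HasRWExpH i (H i) U δ₀ := by
  obtain ⟨M₄, δ₀, a₀, B₀, Bβ, Bε, Bεβ, hM, hδ, ha, hB, HH⟩ := h
  refine ⟨M₄, δ₀, a₀, B₀, Bβ, hM, hδ, ha, hB, fun i hMi α₀ hα hMa U hU h36 => ?_⟩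
  obtain ⟨-, hHk⟩ := HH i hMi α₀ hα hMa U hU h36
  exact hHk (H i) (by simp)

end FromThm312

/-! ## §3 The block's residual printed clause: (3.133) for the literal H of (3.109)–(3.110) -/

section Literal

variable {g : Geometry} {B : Backgrounds}

/-- **(3.133) WITH THE ADDITIONAL FACTOR, FOR THE LITERAL H OF (3.109)–(3.110)** (p. 422 [PDF 34], the sentence after (3.133),
verbatim): *«These inequalities are for the operator H given by the formula (3.126). If we want to have H giving solutions of the
variational problems (3.109), (3.110), then we have to include the additional factor (L^{j′}η)⁻¹ in this formula, and we get (3.133)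
with an additional factor (Lʲη)⁻¹, or (L^{j′}η)⁻¹, on the right-hand side.»*  ((3.133) itself, p. 422: *«|H_{μν}(x, y′)|,
|∇H_{μν}(x, y′)|, ‖ζ∇H(·, y′)‖_β ≦ O(1)[1, (Lʲη)⁻¹, (‖ζ‖^ξ_β + |ζ|)(Lʲη)^{−1−β}](L^{j′}η)^{−d}e^{−(1/2)δ₁d(y,y′)}, for x ∈ Δ(y), or
ζ ∈ C^∞₀(Δ̃(y)), y ∈ Λ_j, y′ ∈ Λ_{j′}»*; (3.110) p. 417: *«LʲηQ_j(U)A = B on Λ_j, j = 0, 1, …, k»*.)  One configuration U, constants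
(C, C(β), δ₁), in the frame of `B9.Ineq3133` — whose body is (3.133) for the H of (3.126) and does NOT carry this clause (its docstring
quotes it) — for an H-kernel `Hlit` (the literal H seen through the same three quantities `B9.HKernel.e 0 ∕ e 1 ∕ h`): each right-hand
side of (3.133) times the additional factor (L^{j′}η)⁻¹ = `(g.len y′)⁻¹`.  READING of print's «(Lʲη)⁻¹, or (L^{j′}η)⁻¹»: the factor of
(3.110) multiplies B at its own site, whose scale index print calls j in (3.110) and j′ in (3.133); in the variables of (3.133) it is
therefore (L^{j′}η)⁻¹ — the form the tree PROVES for the two sup members at concrete letters (`B9Ineq3133KernelConcrete.ineq3133_sup_literal`: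
*«the column of H_lit at y′ is (L^{j′}η)⁻¹ times the column of H»*); the (Lʲη)⁻¹ form differs by the scale transfer of p. 398 ∕ [4] Lemma 2.1
(constants and rate) and is not typed separately.  Hypothesis-form; nothing asserted.
[cite: Balaban1985BackgroundPropagators, p.422 (the sentence after (3.133)) + (3.133) p.422 + (3.110) p.417] -/
def Ineq3133Lit (d : ℕ) (Hlit : HKernel g B) (C : ℝ) (Cβ : ℝ → ℝ) (δ₁ : ℝ) (U : B.Cfg) : Prop :=
  (∀ (n : Fin 2) (y y' : g.Site),
      Hlit.e n U y y' ≤ C * (g.len y) ^ (-(n : ℝ)) * (g.len y') ^ (-(d : ℝ)) *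
        Real.exp (-(δ₁ / 2 * g.dist y y')) * (g.len y')⁻¹) ∧
  (∀ (β : ℝ) (ζ : g.Cut) (y y' : g.Site), 0 ≤ β → β < 1 → g.cutInT ζ y →
      Hlit.h U β ζ y' ≤ Cβ β * g.cutH β ζ * (g.len y) ^ (-(1 + β)) * (g.len y') ^ (-(d : ℝ)) *
        Real.exp (-(δ₁ / 2 * g.dist y y')) * (g.len y')⁻¹)

/-- **Print's «we get», kernel-checked at the level of the typed shapes**: if the literal H-kernel is the H-kernel of (3.126) with every
column at y′ multiplied by (L^{j′}η)⁻¹ (the dictionary `he`, `hh` — H_lit B = H((L^{·}η)⁻¹B), (3.126) with the factor of (3.110)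
included; scale lengths nonnegative, `hlen`), then (3.133) for H (`B9.Ineq3133`) gives (3.133) with the additional factor for H_lit
(`Ineq3133Lit`), same constants. [cite: Balaban1985BackgroundPropagators, p.422 (the sentence after (3.133)) (bookkeeping)] -/
theorem ineq3133Lit_of_ineq3133 {d : ℕ} {H Hlit : HKernel g B} {C : ℝ} {Cβ : ℝ → ℝ} {δ₁ : ℝ} {U : B.Cfg}
    (hlen : ∀ y : g.Site, 0 ≤ g.len y)
    (he : ∀ (n : Fin 2) (y y' : g.Site), Hlit.e n U y y' = H.e n U y y' * (g.len y')⁻¹)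
    (hh : ∀ (β : ℝ) (ζ : g.Cut) (y' : g.Site), Hlit.h U β ζ y' = H.h U β ζ y' * (g.len y')⁻¹)
    (h : Ineq3133 d H C Cβ δ₁ U) : Ineq3133Lit d Hlit C Cβ δ₁ U := by
  refine ⟨fun n y y' => ?_, fun β ζ y y' h0 h1 hζ => ?_⟩
  · rw [he]
    exact mul_le_mul_of_nonneg_right (h.1 n y y') (inv_nonneg.2 (hlen y'))
  · rw [hh]
    exact mul_le_mul_of_nonneg_right (h.2 β ζ y y' h0 h1 hζ) (inv_nonneg.2 (hlen y'))

/-- **(3.133)-WITH-THE-FACTOR AS A FAMILY STATEMENT** for a family of literal H-kernels `Hlit i` (the H solving (3.109)–(3.110) at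
each member), in the quantifier template of `B9.Stmt3132Printed` ∕ `B9.Thm312Printed` — constants (C, C(β), δ₁) and thresholds
(M₄, a₀) BEFORE the member i (p. 399 l. 1–3, p. 416: d, L only); hypotheses M ≧ M₄ (*«M sufficiently large»*, inherited from Theorems
3.1–3.10 through «Theorem 3.3 for G»), 0 < α₀, Mα₀ ≦ a₀ (p. 422 *«for α₀ sufficiently small»*), U in the classes (3.35) AND (3.36)
(p. 419 *«From now on we assume that U satisfies the regularity conditions (3.35), (3.36)»*).  Hypothesis-form; nothing asserted;
print's derivation is `stmt3133Lit_of_thm312Printed`. [cite: Balaban1985BackgroundPropagators, p.422 (the sentence after (3.133)) + (3.133) p.422] -/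
def Stmt3133LitPrinted {I : Type} (d : ℕ) (c35 : ℝ) (geo : I → Geometry) (bg : I → Backgrounds)
    (Hlit : ∀ i, HKernel (geo i) (bg i)) : Prop :=
  ∃ M₄ δ₁ a₀ C : ℝ, ∃ Cβ : ℝ → ℝ, 0 < M₄ ∧ 0 < δ₁ ∧ 0 < a₀ ∧ 0 < C ∧
    ∀ i : I, M₄ ≤ (geo i).M → ∀ α₀ : ℝ, 0 < α₀ → (geo i).M * α₀ ≤ a₀ →
      ∀ U : (bg i).Cfg, (bg i).Reg335 c35 α₀ U → (bg i).Reg336 c35 α₀ U → Ineq3133Lit d (Hlit i) C Cβ δ₁ U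

/-- **p. 422, «and we get (3.133) with an additional factor» — from Theorem 3.12's (3.133)-clause for the H of (3.126)** (`B9.Thm312Printed`,
block 10) and the column dictionary between H and the literal H at every member and configuration: the family statement
`Stmt3133LitPrinted` (kernel-checked bookkeeping; no sign facts beyond nonnegative scale lengths).
[cite: Balaban1985BackgroundPropagators, p.422 (the sentence after (3.133)), Thm 3.12 p.423 (bookkeeping)] -/
theorem stmt3133Lit_of_thm312Printed {I : Type} {d : ℕ} {c35 : ℝ} {geo : I → Geometry} {bg : I → Backgrounds}
    {GD G₁ : ∀ i, KernelFamily (geo i) (bg i)} {H H₁ Hlit : ∀ i, HKernel (geo i) (bg i)}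
    {HasRWExp : ∀ i, KernelFamily (geo i) (bg i) → (bg i).Cfg → ℝ → Prop}
    {HasRWExpH : ∀ i, HKernel (geo i) (bg i) → (bg i).Cfg → ℝ → Prop}
    {PosDefK : ∀ i, KernelFamily (geo i) (bg i) → (bg i).Cfg → Prop}
    (hlen : ∀ (i : I) (y : (geo i).Site), 0 ≤ (geo i).len y)
    (he : ∀ (i : I) (U : (bg i).Cfg) (n : Fin 2) (y y' : (geo i).Site),
      (Hlit i).e n U y y' = (H i).e n U y y' * ((geo i).len y')⁻¹)
    (hh : ∀ (i : I) (U : (bg i).Cfg) (β : ℝ) (ζ : (geo i).Cut) (y' : (geo i).Site),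
      (Hlit i).h U β ζ y' = (H i).h U β ζ y' * ((geo i).len y')⁻¹)
    (h : Thm312Printed d c35 geo bg GD G₁ H H₁ HasRWExp HasRWExpH PosDefK) :
    Stmt3133LitPrinted d c35 geo bg Hlit := by
  obtain ⟨M₄, δ₀, a₀, B₀, Bβ, hM, hδ, ha, hB, HH⟩ := ineq3133_H_of_thm312Printed h
  refine ⟨M₄, δ₀, a₀, B₀, Bβ, hM, hδ, ha, hB, fun i hMi α₀ hα hMa U hU h36 => ?_⟩
  exact ineq3133Lit_of_ineq3133 (hlen i) (he i U) (hh i U) (HH i hMi α₀ hα hMa U hU h36).1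

end Literal

end Literature.MathematicalPhysics.QuantumFieldTheory.Balaban1983to89.B9Carve09Thms310to311Hyp
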